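import Summits.KontsevichZagierPeriods.KontsevichZagierPeriods.Theorems.RootDecompWalshStrataQuadricWalls02

/-!
# The `z`-glue with affine walls, part 3/4: `[wallCell, q] ∈ InBaker` for `A ≠ 0` modulo `γ√D` on wall atoms

Declarations `Quadric₃.wallCell` … `Quadric₃.inBaker_wallCell` of the farm-checked gen-7 file: `inBaker_kapRoot_atom`
(one root clamped into `[ℓ₁, ℓ₂]` on one wall-family atom: `ℓ₁`-affine / `ℓ₂`-affine / affine + `(sε/(2A))√D`),
`inBaker_wlen_atom`, `inBaker_wallCell_of_neg` (band over the base region between the clamped roots, rule (3), then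
`InBaker.of_partition` over the wall-family atoms), `inBaker_wallCell_of_pos` (complement in the wall box; `{p = 0}`
a proper zero set), `inBaker_wallCell` (`A ≠ 0`; the residual is spelled out as the hypothesis `hW`, no `Prop` is
declared).  See the module docstring of `RootDecompWalshStrataQuadricWalls01` (part 1).
[KontsevichZagier2001 §1.2 rules (1),(3); BCR1998 §2.2; this node gen 7]
-/

noncomputable section

open Literature.NumberTheory.Transcendental
open MeasureTheory Set
open MvPolynomial (aeval X C)
open Literature.ModelTheory.ExponentialFields (IsSemialgebraic isSemialgebraic_univ
  isSemialgebraic_setOf_eval_pos isSemialgebraic_setOf_eval_lt isSemialgebraic_setOf_eval_le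
  isSemialgebraic_setOf_eval_nonneg isSemialgebraic_setOf_eval_eq_zero
  isSemialgebraic_setOf_eval_ne_zero continuous_aeval_real tarski_seidenberg_real_holds)
open Summit.KontsevichZagierPeriods.RootDecompWalshStrata.WalshSpanProof (isSemialgebraic_cubeSet
  isBounded_cubeSet)
open Summit.KontsevichZagierPeriods.RootDecompWalshStrata.ConeSpecimen (unitIoo isSemialgebraic_unitIoo
  unitIoo_subset_Icc mem_unitIoo)
open Summit.KontsevichZagierPeriods.RootDecompWalshStrata.PointlessOctant (boxTwo isSemialgebraic_boxTwo
  boxTwo_subset_Icc)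

namespace Summit.KontsevichZagierPeriods.RootDecompWalshStrata.ConicDescent.BallCube

/-- `Fin.last 2 = 2` in `Fin 3` (PRIVATE copy of the CellThree01 helper; landed twin outside this chain,
gate lint `dedup.landed`). [folklore] -/
private theorem last_two₃ : (Fin.last 2 : Fin 3) = 2 := rfl

namespace Quadric₃

variable (K : Quadric₃)

/-- The WALL CELL `wallBox ∩ {p > 0}`. -/
def wallCell (ℓ₁ ℓ₂ g : Wall) : Set (Fin 3 → ℝ) :=
  {z | z ∈ wallBox ℓ₁ ℓ₂ g ∧ 0 < K.pxyz (z 0) (z 1) (z 2)}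

/-- Wall cells are `ℚ`-semialgebraic. [BCR1998 §2.2] -/
theorem isSemialgebraic_wallCell (ℓ₁ ℓ₂ g : Wall) : IsSemialgebraic ℚ (K.wallCell ℓ₁ ℓ₂ g) := by
  convert (isSemialgebraic_wallBox ℓ₁ ℓ₂ g).inter
    (isSemialgebraic_setOf_eval_pos (R := ℝ) K.PxyzP) using 1
  ext z
  simp only [wallCell, mem_setOf_eq, mem_inter_iff, Quadric₃.aeval_PxyzP]

/-- **One clamped root on one wall-family atom** (`A ≠ 0`): `[atom, s·κ(root ε)]` lands in the
Baker sector in each regime of the trichotomy (`κ = ℓ₁` affine, `κ = ℓ₂` affine, or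
`s·root ε = affine + (sε/(2A))·√D` = `InBaker.quad_atomFam` plus the residual `γ√D`).
[KontsevichZagier2001 §1.2 rule (1); this node] -/
theorem inBaker_kapRoot_atom (hA : K.A ≠ 0) (ℓ₁ ℓ₂ g : Wall)
    (hW : ∀ (γ : ℚ) (σ : Fin 6 → SignType) (r : KZ.IntegralRep 2),
      r.domain = atomFam (K.wfam ℓ₁ ℓ₂ g) σ →
      EqOn r.integrand (fun v => (γ : ℝ) * √(K.Dxy (v 0) (v 1))) r.domain → InBaker (KZ.of r))
    (σ : Fin 6 → SignType) (s ε : ℚ)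
    (h12 : ∀ v ∈ atomFam (K.wfam ℓ₁ ℓ₂ g) σ, ℓ₁.eval (v 0) (v 1) ≤ ℓ₂.eval (v 0) (v 1))
    (hcase : (∀ v ∈ atomFam (K.wfam ℓ₁ ℓ₂ g) σ, K.root ε (v 0) (v 1) ≤ ℓ₁.eval (v 0) (v 1)) ∨
      (∀ v ∈ atomFam (K.wfam ℓ₁ ℓ₂ g) σ, ℓ₂.eval (v 0) (v 1) ≤ K.root ε (v 0) (v 1)) ∨
      (∀ v ∈ atomFam (K.wfam ℓ₁ ℓ₂ g) σ, ℓ₁.eval (v 0) (v 1) < K.root ε (v 0) (v 1) ∧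
        K.root ε (v 0) (v 1) < ℓ₂.eval (v 0) (v 1)))
    (r : KZ.IntegralRep 2) (hrd : r.domain = atomFam (K.wfam ℓ₁ ℓ₂ g) σ)
    (hri : EqOn r.integrand (fun v => (s : ℝ) *
      kap (ℓ₁.eval (v 0) (v 1)) (ℓ₂.eval (v 0) (v 1)) (K.root ε (v 0) (v 1))) r.domain) :
    InBaker (KZ.of r) := by
  rcases hcase with h | h | h
  · refine InBaker.quad_atomFam _ σ (Wall.lin s ℓ₁ 0 ℓ₁).toConic r hrd fun v hv => ?_
    beta_reduce
    rw [hri hv]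
    beta_reduce
    rw [Wall.toConic_pxy, Wall.lin_eval, kap_of_le_left (h v (hrd ▸ hv))]
    push_cast; ring
  · refine InBaker.quad_atomFam _ σ (Wall.lin s ℓ₂ 0 ℓ₂).toConic r hrd fun v hv => ?_
    beta_reduce
    rw [hri hv]
    beta_reduce
    rw [Wall.toConic_pxy, Wall.lin_eval, kap_of_right_le (h v (hrd ▸ hv)) (h12 v (hrd ▸ hv))]
    push_cast; ring
  · have hI : r.domain ⊆ Icc 0 1 := hrd ▸ fun v hv => boxTwo_subset_Icc hv.1
    set p : MvPolynomial (Fin 2) ℚ := C (-(s * K.b0) / (2 * K.A)) +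
      C (-(s * K.b1) / (2 * K.A)) * X 0 + C (-(s * K.b2) / (2 * K.A)) * X 1 with hp
    set r₂ : KZ.IntegralRep 2 := polyRep₁ r.domain r.isSemialgebraic_domain hI p with hr₂
    have h₂ : InBaker (KZ.of r₂) :=
      InBaker.quad_atomFam _ σ ⟨0, -(s * K.b2) / (2 * K.A), 0, -(s * K.b0) / (2 * K.A),
        -(s * K.b1) / (2 * K.A), 0⟩ r₂ (by rw [hr₂, polyRep₁_domain, hrd]) fun v _ => by
        simp only [hr₂, polyRep₁_integrand, hp, map_add, map_mul, MvPolynomial.aeval_C,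
          MvPolynomial.aeval_X, eq_ratCast, Conic.pxy, Conic.Bx, Conic.Cx]
        push_cast; ring
    refine InBaker.of_sub' r r₂ rfl h₂
      (hW (s * ε / (2 * K.A)) σ _ (by rw [subRep_domain, hrd]) fun v hv => ?_)
    have hv' : v ∈ atomFam (K.wfam ℓ₁ ℓ₂ g) σ := by rw [← hrd]; exact hv
    obtain ⟨h0, h1⟩ := h v hv'
    rw [subRep_integrand, hri hv]
    beta_reduce
    rw [kap_of_mem h0.le h1.le]
    simp only [hr₂, polyRep₁_integrand, hp, map_add, map_mul, MvPolynomial.aeval_C,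
      MvPolynomial.aeval_X, eq_ratCast, root, Bxy]
    have hA' : (K.A : ℝ) ≠ 0 := by exact_mod_cast hA
    push_cast
    field_simp
    ring

/-- **The length integrand on one wall-family atom** (`A < 0`): `[atom, q·(κ(hi) − κ(lo))]` lands in
the Baker sector; on an atom with `D ≤ 0` the integrand vanishes. [this node] -/
theorem inBaker_wlen_atom (hA : K.A < 0) (ℓ₁ ℓ₂ g : Wall) (q : ℚ)
    (hW : ∀ (γ : ℚ) (σ : Fin 6 → SignType) (r : KZ.IntegralRep 2),
      r.domain = atomFam (K.wfam ℓ₁ ℓ₂ g) σ →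
      EqOn r.integrand (fun v => (γ : ℝ) * √(K.Dxy (v 0) (v 1))) r.domain → InBaker (KZ.of r))
    (σ : Fin 6 → SignType)
    (h012 : ∀ v ∈ atomFam (K.wfam ℓ₁ ℓ₂ g) σ, 0 ≤ ℓ₁.eval (v 0) (v 1) ∧
      ℓ₁.eval (v 0) (v 1) ≤ ℓ₂.eval (v 0) (v 1) ∧ ℓ₂.eval (v 0) (v 1) ≤ 1)
    (r : KZ.IntegralRep 2) (hrd : r.domain = atomFam (K.wfam ℓ₁ ℓ₂ g) σ)
    (hri : EqOn r.integrand (fun v => (q : ℝ) *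
      (kap (ℓ₁.eval (v 0) (v 1)) (ℓ₂.eval (v 0) (v 1)) (K.hi (v 0) (v 1)) -
        kap (ℓ₁.eval (v 0) (v 1)) (ℓ₂.eval (v 0) (v 1)) (K.lo (v 0) (v 1)))) r.domain) :
    InBaker (KZ.of r) := by
  by_cases hσ : σ 0 = 1
  · have hI : r.domain ⊆ Icc 0 1 := hrd ▸ fun v hv => boxTwo_subset_Icc hv.1
    have hb : Bornology.IsBounded r.domain :=
      (isCompact_Icc (a := (0 : Fin 2 → ℝ)) (b := 1)).isBounded.subset hI
    have hrs := r.isSemialgebraic_domain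
    set r₂ : KZ.IntegralRep 2 := bddRep r.domain hrs hb
      (fun v => (q : ℝ) * kap (ℓ₁.eval (v 0) (v 1)) (ℓ₂.eval (v 0) (v 1)) (K.hi (v 0) (v 1)))
      ((IsSemialgebraicFunOn.mul_holds (isSemialgebraicFunOn_ratCast hrs q)
        (IsSemialgebraicFunOn.kap hrs (ℓ₁.isSemialgebraicFunOn_eval hrs)
          (ℓ₂.isSemialgebraicFunOn_eval hrs) (K.isSemialgebraicFunOn_hi hrs))).congr fun _ _ => rfl)
      |(q : ℝ)| (fun v hv => by
        obtain ⟨h0, h12, h1⟩ := h012 v (hrd ▸ hv)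
        rw [abs_mul]
        exact mul_le_of_le_one_right (abs_nonneg _) (abs_le.2
          ⟨by linarith [le_kap (ℓ₁.eval (v 0) (v 1)) (ℓ₂.eval (v 0) (v 1)) (K.hi (v 0) (v 1))],
            (kap_le h12 _).trans h1⟩)) with hr₂
    have h₂ : InBaker (KZ.of r₂) :=
      K.inBaker_kapRoot_atom hA.ne ℓ₁ ℓ₂ g hW σ q (-1) (fun v hv => (h012 v hv).2.1)
        (K.kap_hi_cases hA ℓ₁ ℓ₂ g σ hσ) r₂ (by rw [hr₂, bddRep_domain, hrd]) fun v _ => by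
        simp [hr₂, hi]
    refine InBaker.of_sub' r r₂ rfl h₂ (K.inBaker_kapRoot_atom hA.ne ℓ₁ ℓ₂ g hW σ (-q) 1
      (fun v hv => (h012 v hv).2.1) (K.kap_lo_cases hA ℓ₁ ℓ₂ g σ hσ) _
      (by rw [subRep_domain, hrd]) fun v hv => ?_)
    rw [subRep_integrand, hri hv]
    simp only [hr₂, bddRep_integrand, lo]
    push_cast; ring
  · refine InBaker.of_mem_relations (KZ.of_mem_relations_of_eqOn_zero r fun v hv => ?_)
    have hv' : v ∈ atomFam (K.wfam ℓ₁ ℓ₂ g) σ := by rw [← hrd]; exact hv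
    have h0 := K.sqrt_Dxy_eq_zero_of_wsign ℓ₁ ℓ₂ g σ hσ hv'
    rw [hri hv]
    simp [hi_eq, lo_eq, h0]

/-- **`A < 0`.** `[wallCell, q]` lands in the Baker sector, given `[atom, γ√D] ∈ InBaker` on the atoms
of the wall family: the wall cell is the band over the base region between the roots clamped into
`[ℓ₁, ℓ₂]` (rule 3), the length representation is split over the atoms (rule 1a), and each atom is
`inBaker_wlen_atom`. [KontsevichZagier2001 §1.2; this node] -/
theorem inBaker_wallCell_of_neg (hA : K.A < 0) (ℓ₁ ℓ₂ g : Wall)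
    (hwall : ∀ v ∈ Wbase g, 0 ≤ ℓ₁.eval (v 0) (v 1) ∧
      ℓ₁.eval (v 0) (v 1) ≤ ℓ₂.eval (v 0) (v 1) ∧ ℓ₂.eval (v 0) (v 1) ≤ 1)
    (q : ℚ)
    (hW : ∀ (γ : ℚ) (σ : Fin 6 → SignType) (r : KZ.IntegralRep 2),
      r.domain = atomFam (K.wfam ℓ₁ ℓ₂ g) σ →
      EqOn r.integrand (fun v => (γ : ℝ) * √(K.Dxy (v 0) (v 1))) r.domain → InBaker (KZ.of r))
    (ρ : KZ.IntegralRep 3) (hdom : ρ.domain = K.wallCell ℓ₁ ℓ₂ g)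
    (hint : ∀ z ∈ ρ.domain, ρ.integrand z = q) : InBaker (KZ.of ρ) := by
  classical
  have hXs := isSemialgebraic_Wbase g
  have hXI : Wbase g ⊆ Icc 0 1 := fun v hv => boxTwo_subset_Icc hv.1
  have hl := IsSemialgebraicFunOn.kap hXs (ℓ₁.isSemialgebraicFunOn_eval hXs)
    (ℓ₂.isSemialgebraicFunOn_eval hXs) (K.isSemialgebraicFunOn_lo hXs)
  have hu := IsSemialgebraicFunOn.kap hXs (ℓ₁.isSemialgebraicFunOn_eval hXs)
    (ℓ₂.isSemialgebraicFunOn_eval hXs) (K.isSemialgebraicFunOn_hi hXs)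
  have hdomeq : ρ.domain = oband (Wbase g)
      (fun v => kap (ℓ₁.eval (v 0) (v 1)) (ℓ₂.eval (v 0) (v 1)) (K.lo (v 0) (v 1)))
      fun v => kap (ℓ₁.eval (v 0) (v 1)) (ℓ₂.eval (v 0) (v 1)) (K.hi (v 0) (v 1)) := by
    rw [hdom]
    ext z
    simp only [wallCell, wallBox, Wbase, mem_setOf_eq, mem_oband, cube_iff, init₃_apply_zero,
      init₃_apply_one, last_two₃]
    constructor
    · rintro ⟨⟨⟨h2, hz0, hz1⟩, hg, hl1, hl2⟩, hp⟩
      obtain ⟨-, hlo, hhi⟩ := (K.pos_iff_of_neg hA _ _ _).1 hp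
      exact ⟨⟨h2, hg⟩, (kap_lt_iff hl1 hl2).2 hlo, (lt_kap_iff hl1 hl2).2 hhi⟩
    · rintro ⟨⟨h2, hg⟩, hlo, hhi⟩
      obtain ⟨h0, h12, h1⟩ := hwall (Fin.init z) ⟨h2, hg⟩
      simp only [init₃_apply_zero, init₃_apply_one] at h0 h12 h1
      have hl1 : ℓ₁.eval (z 0) (z 1) < z 2 := (le_kap _ _ _).trans_lt hlo
      have hl2 : z 2 < ℓ₂.eval (z 0) (z 1) := hhi.trans_le (kap_le h12 _)
      refine ⟨⟨⟨h2, by linarith, by linarith⟩, hg, hl1, hl2⟩, (K.pos_iff_of_neg hA _ _ _).2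
        ⟨?_, (kap_lt_iff hl1 hl2).1 hlo, (lt_kap_iff hl1 hl2).1 hhi⟩⟩
      by_contra hD
      have h0 : √(K.Dxy (z 0) (z 1)) = 0 := Real.sqrt_eq_zero'.2 (not_lt.1 hD)
      have heq : K.lo (z 0) (z 1) = K.hi (z 0) (z 1) := by
        rw [lo_eq, hi_eq, h0, add_zero, sub_zero]
      rw [heq] at hlo
      exact lt_irrefl _ (hlo.trans hhi)
  refine InBaker.of_band ρ (Wbase g) hXs hXI _ _ hl hu
    (fun v hv => (hwall v hv).1.trans (le_kap _ _ _))
    (fun v hv => kap_mono _ _ (K.lo_le_hi hA _ _))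
    (fun v hv => (kap_le (hwall v hv).2.1 _).trans (hwall v hv).2.2) q hdomeq hint ?_
  refine InBaker.of_partition (Finset.univ : Finset (Fin 6 → SignType)) _
    (fun σ => atomFam (K.wfam ℓ₁ ℓ₂ g) σ) (fun σ _ => isSemialgebraic_atomFam _ σ)
    (fun v hv => ⟨_, Finset.mem_univ _, mem_atomFam_sign _ hv.1⟩)
    (fun σ τ v hne h₁ h₂ => hne (atomFam_eq_of_mem _ h₁ h₂)) fun σ _ T hT hTr hTeq => ?_
  by_cases h5 : σ 5 = 1
  · have hsub : atomFam (K.wfam ℓ₁ ℓ₂ g) σ ⊆ Wbase g := fun v hv =>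
      ⟨hv.1, sign_eq_one_iff.1 ((K.wfam_sign ℓ₁ ℓ₂ g σ hv).2.2.2.2.2.trans h5)⟩
    have hTa : T = atomFam (K.wfam ℓ₁ ℓ₂ g) σ := by
      rw [hTeq]; exact inter_eq_right.2 hsub
    exact K.inBaker_wlen_atom hA ℓ₁ ℓ₂ g q hW σ (fun v hv => hwall v (hsub hv)) _ hTa fun v _ => rfl
  · refine InBaker.of_domain_eq_empty _ (Set.eq_empty_iff_forall_notMem.2 fun v hv => h5 ?_)
    have hv' : v ∈ T := hv
    rw [hTeq] at hv'
    exact (K.wfam_sign ℓ₁ ℓ₂ g σ hv'.2).2.2.2.2.2.symm.trans (sign_eq_one_iff.2 hv'.1.2)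

/-! #### 31.5 `A > 0` by complement in the wall box; `A ≠ 0` -/

/-- The negated form has the negated walls family up to the discriminant; we only need its cell:
`K.neg.wallCell = wallBox ∩ {p < 0}`. [this node] -/
theorem mem_neg_wallCell_iff (ℓ₁ ℓ₂ g : Wall) (z : Fin 3 → ℝ) :
    z ∈ K.neg.wallCell ℓ₁ ℓ₂ g ↔ z ∈ wallBox ℓ₁ ℓ₂ g ∧ K.pxyz (z 0) (z 1) (z 2) < 0 := by
  simp only [wallCell, mem_setOf_eq, Quadric₃.neg_pxyz, neg_pos]

/-- **`A > 0`.** `[wallCell(p), q] = [wallBox, q] − [wallCell(−p), q] − [{p = 0} ∩ wallBox, q]`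
(rule 1a): `inBaker_wallBox`, `inBaker_wallCell_of_neg` for `−p`, and `{p = 0}` is a proper
algebraic set (`InBaker.of_subset_zeroSet`). [KontsevichZagier2001 §1.2; this node] -/
theorem inBaker_wallCell_of_pos (hA : 0 < K.A) (ℓ₁ ℓ₂ g : Wall)
    (hwall : ∀ v ∈ Wbase g, 0 ≤ ℓ₁.eval (v 0) (v 1) ∧
      ℓ₁.eval (v 0) (v 1) ≤ ℓ₂.eval (v 0) (v 1) ∧ ℓ₂.eval (v 0) (v 1) ≤ 1)
    (q : ℚ)
    (hWn : ∀ (γ : ℚ) (σ : Fin 6 → SignType) (r : KZ.IntegralRep 2),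
      r.domain = atomFam (K.neg.wfam ℓ₁ ℓ₂ g) σ →
      EqOn r.integrand (fun v => (γ : ℝ) * √(K.neg.Dxy (v 0) (v 1))) r.domain → InBaker (KZ.of r))
    (ρ : KZ.IntegralRep 3) (hdom : ρ.domain = K.wallCell ℓ₁ ℓ₂ g)
    (hint : ∀ z ∈ ρ.domain, ρ.integrand z = q) : InBaker (KZ.of ρ) := by
  classical
  have hbox : IsSemialgebraic ℚ (wallBox ℓ₁ ℓ₂ g) := isSemialgebraic_wallBox ℓ₁ ℓ₂ g
  have hboxI : wallBox ℓ₁ ℓ₂ g ⊆ Icc 0 1 := wallBox_subset_Icc ℓ₁ ℓ₂ g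
  set ρ' : KZ.IntegralRep 3 := polyRep₁ (wallBox ℓ₁ ℓ₂ g) hbox hboxI (MvPolynomial.C q) with hρ'def
  have hρ'i : ∀ z, ρ'.integrand z = q := fun z => by simp [hρ'def]
  have hsq : InBaker (KZ.of ρ') :=
    inBaker_wallBox ℓ₁ ℓ₂ g hwall q ρ' (by rw [hρ'def, polyRep₁_domain]) fun z _ => hρ'i z
  set A₃ : Set (Fin 3 → ℝ) := {z | z ∈ wallBox ℓ₁ ℓ₂ g ∧ K.pxyz (z 0) (z 1) (z 2) = 0} with hA₃def
  have hA₁ : IsSemialgebraic ℚ (K.wallCell ℓ₁ ℓ₂ g) := K.isSemialgebraic_wallCell ℓ₁ ℓ₂ g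
  have hA₂ : IsSemialgebraic ℚ (K.neg.wallCell ℓ₁ ℓ₂ g) := K.neg.isSemialgebraic_wallCell ℓ₁ ℓ₂ g
  have hA₃ : IsSemialgebraic ℚ A₃ := by
    convert hbox.inter (isSemialgebraic_setOf_eval_eq_zero (R := ℝ) K.PxyzP) using 1
    ext z
    simp only [hA₃def, mem_setOf_eq, mem_inter_iff, Quadric₃.aeval_PxyzP]
  have hcov : ρ'.domain = K.wallCell ℓ₁ ℓ₂ g ∪ (K.neg.wallCell ℓ₁ ℓ₂ g ∪ A₃) := by
    ext z
    simp only [hρ'def, polyRep₁_domain, mem_union, Quadric₃.wallCell, hA₃def, mem_setOf_eq,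
      Quadric₃.neg_pxyz, neg_pos]
    constructor
    · intro hz
      rcases lt_trichotomy (K.pxyz (z 0) (z 1) (z 2)) 0 with h | h | h
      · exact Or.inr (Or.inl ⟨hz, h⟩)
      · exact Or.inr (Or.inr ⟨hz, h⟩)
      · exact Or.inl ⟨hz, h⟩
    · rintro (⟨hz, _⟩ | ⟨hz, _⟩ | ⟨hz, _⟩) <;> exact hz
  have h1r : K.wallCell ℓ₁ ℓ₂ g ⊆ ρ'.domain := fun z hz => hcov ▸ Or.inl hz
  have h23r : K.neg.wallCell ℓ₁ ℓ₂ g ∪ A₃ ⊆ ρ'.domain := fun z hz => hcov ▸ Or.inr hz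
  have hrel := of_sub_restrict_sub_restrict_mem_relations ρ' hA₁ (hA₂.union hA₃) h1r h23r hcov (by
    have : K.wallCell ℓ₁ ℓ₂ g ∩ (K.neg.wallCell ℓ₁ ℓ₂ g ∪ A₃) = ∅ := by
      ext z
      refine ⟨fun hz => ?_, fun h => h.elim⟩
      obtain ⟨hz1, hz2⟩ := hz
      have hp1 : 0 < K.pxyz (z 0) (z 1) (z 2) := hz1.2
      rcases hz2 with hz2 | hz2
      · have hp2 := ((K.mem_neg_wallCell_iff ℓ₁ ℓ₂ g z).1 hz2).2
        exact False.elim (by linarith)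
      · have hp2 : K.pxyz (z 0) (z 1) (z 2) = 0 := hz2.2
        exact False.elim (by linarith)
    rw [this, measure_empty])
  have h23 : InBaker (KZ.of (ρ'.restrict _ (hA₂.union hA₃) h23r)) := by
    refine InBaker.of_split _ hA₂ hA₃ (fun z hz => Or.inl hz) (fun z hz => Or.inr hz) rfl ?_ ?_ ?_
    · have : K.neg.wallCell ℓ₁ ℓ₂ g ∩ A₃ = ∅ := by
        ext z
        refine ⟨fun hz => ?_, fun h => h.elim⟩
        obtain ⟨hz1, hz2⟩ := hz
        have hp1 := ((K.mem_neg_wallCell_iff ℓ₁ ℓ₂ g z).1 hz1).2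
        have hp2 : K.pxyz (z 0) (z 1) (z 2) = 0 := hz2.2
        exact False.elim (by linarith)
      rw [this, measure_empty]
    · have hA' : K.neg.A < 0 := by rw [Quadric₃.neg_A]; linarith
      exact K.neg.inBaker_wallCell_of_neg hA' ℓ₁ ℓ₂ g hwall q hWn _ rfl fun z _ => hρ'i z
    · exact InBaker.of_subset_zeroSet _ K.PxyzP (K.exists_aeval_PxyzP_ne_zero hA.ne')
        fun z hz => by rw [Quadric₃.aeval_PxyzP]; exact hz.2
  have h1 : InBaker (KZ.of (ρ'.restrict _ hA₁ h1r)) := by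
    refine (hsq.sub h23).congr ?_
    have : KZ.of (ρ'.restrict _ hA₁ h1r) - (KZ.of ρ' - KZ.of (ρ'.restrict _ (hA₂.union hA₃) h23r)) =
        -(KZ.of ρ' - KZ.of (ρ'.restrict _ hA₁ h1r) - KZ.of (ρ'.restrict _ (hA₂.union hA₃) h23r)) := by
      abel
    rw [this]
    exact KZ.relations.neg_mem hrel
  refine h1.congr (KZ.of_sub_of_mem_relations_of_eqOn (by simp [hdom]) fun z hz => ?_)
  rw [hint z hz]
  exact (hρ'i z).symm

/-- **The wall cell for `A ≠ 0`**, given `[atom, γ√D] ∈ InBaker` on the wall-family atoms of every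
normal form (only `K` and `−K` are used). [KontsevichZagier2001 §1.2; this node] -/
theorem inBaker_wallCell (hA : K.A ≠ 0) (ℓ₁ ℓ₂ g : Wall)
    (hwall : ∀ v ∈ Wbase g, 0 ≤ ℓ₁.eval (v 0) (v 1) ∧
      ℓ₁.eval (v 0) (v 1) ≤ ℓ₂.eval (v 0) (v 1) ∧ ℓ₂.eval (v 0) (v 1) ≤ 1)
    (q : ℚ)
    (hW : ∀ (M : Quadric₃) (γ : ℚ) (σ : Fin 6 → SignType) (r : KZ.IntegralRep 2),
      r.domain = atomFam (M.wfam ℓ₁ ℓ₂ g) σ →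
      EqOn r.integrand (fun v => (γ : ℝ) * √(M.Dxy (v 0) (v 1))) r.domain → InBaker (KZ.of r))
    (ρ : KZ.IntegralRep 3) (hdom : ρ.domain = K.wallCell ℓ₁ ℓ₂ g)
    (hint : ∀ z ∈ ρ.domain, ρ.integrand z = q) : InBaker (KZ.of ρ) := by
  rcases lt_or_gt_of_ne hA with h | h
  · exact K.inBaker_wallCell_of_neg h ℓ₁ ℓ₂ g hwall q (hW K) ρ hdom hint
  · exact K.inBaker_wallCell_of_pos h ℓ₁ ℓ₂ g hwall q (hW K.neg) ρ hdom hint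

end Quadric₃

end Summit.KontsevichZagierPeriods.RootDecompWalshStrata.ConicDescent.BallCube
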